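import Mathlib
import HarnessLib
import Summits.HubbardSuperconductivity.HubbardSuperconductivity.Theorems.KLProgrammeKLRegimeCountertermOneVolumeJA
import Summits.HubbardSuperconductivity.HubbardSuperconductivity.Theorems.KLProgrammeKLRegimeCountertermSlotBudgetSelfMap

/-!
# Route `KLProgramme` — child Counterterm of crux K3: the DEGREE-CAPPED frame class — child 2's provider for `ct_oneVolume_thresholdsJA`
# (seat hubbard-kl-k3c3-p2, «fixed point on FrameOK's tube»)

p1b g7's finding F2 (SCALE0-TWOLEG-EXPORTS.md, evidence #25 on stmt-HubbardSuperconductivity-19918): at scale `0` the (E3c) clause is false as typed for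
LATTICE-INVISIBLE comparison frames (degree `≥ L/2`); the repair menu's (R-deg) adds a DEGREE clause to the admissible class, `K.degree ≤ cap`, with the
engine's volume threshold `L₃ > 2·cap`.  Child 2's side of (R-deg), whichever cap the typist chooses (`cap β U`, e.g. `klFrameDeg β` or an `R`-field times
`16^{nScales β}`): its frames are the zero frame (degree `0`) and Jackson means `ctIterJ L M d … = jacksonFrame d (…)` of degree `d + d` (`rfl`), with `d`
the canonical degree of `jacksonDeg_cond`; so the class `A β U μ K := FrameOK (ctRenMs G) U (nScales β) μ K ∧ K.degree ≤ cap β U` has a provider as soon as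
`2·⌈π⁶·B₁·(1+q)(1+2q)/(|U|16^{−N}/256)⌉₊ ≤ cap β U` in the regime (`B₁ = Σ_{i≤N} twoLegBar 1 i`, `q = (4/3)(SL+SL′|U|)|U|`) — the one hypothesis `hcap` below.

* `ctIterJ_degree` (`rfl`), `canonicalJacksonDeg` is NOT a def: the degree is written out;
* **`selfMapProviderA_degCap`** — the provider for the degree-capped class with today's (E3a-MS) text (`X := TwoLegSizesMSFn … K.eval`);
* **`selfMapProviderA_degCap_of_slotBudget`** — the same with the (E3a-MS) conjunct an ARBITRARY `X` that yields slot decompositions under an abstract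
  budget `B` with the room of `frameOK_jackson_of_slotBudget` (so (R-deg) and an MS re-type together are still one provider).
* §2 (appended): `two_mul_jacksonDeg_le_numeral` (twice the canonical degree `≤ 2^21·16^{nScales β}` below an explicit `U₆(G,Q)`),
  `selfMapProviderA_degCap'` (cap asked below a `U`-threshold only), `selfMapProviderA_degCap_numeral` (the typist's `2^21·16^N`, hypothesis-free).
Proofs only; no slot text is proposed; nothing is asserted about the Hubbard model.
-/

noncomputable section

namespace Summit.HubbardSuperconductivity.HubbardSuperconductivity.Theorems.KLRegimeSplit

set_option linter.dupNamespace false -- summit = problem name (single-conjunct summit), D-0017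

open Real Finset
open Literature.MathematicalPhysics.QuantumLattice Literature.Probability.LatticeModels
open Summit.HubbardSuperconductivity.HubbardSuperconductivity.Theorems.KLProgrammeLegKernels

/-- The smoothed Picard iterate has degree `d + d`. -/
theorem ctIterJ_degree (L M : ℕ) [NeZero L] [NeZero M] (d : ℕ) (β U μ : ℝ) (K : TrigPolyC4v) (n : ℕ) :
    (ctIterJ L M d β U μ K n).degree = d + d := rfl

/-- **Provider for the DEGREE-CAPPED class, today's (E3a-MS) text.**  `A β U μ K := FrameOK (ctRenMs G) U (nScales β) μ K ∧ K.degree ≤ cap β U`,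
`X := TwoLegSizesMSFn … K.eval`; hypothesis `hcap`: in the regime (below the returned thresholds is enough, but we ask it for all `0 < U ≤ 1`, every
`β ≥ klBetaMin`) the cap dominates twice the canonical Jackson degree. -/
theorem selfMapProviderA_degCap (G : GeoConsts) (Q : EngConsts) (hG : G.WF) (hQ : Q.WF) (cap : ℝ → ℝ → ℕ)
    (hcap : ∀ U β : ℝ, 0 < U → U ≤ 1 → klBetaMin ≤ β →
      2 * ⌈π ^ 6 * (∑ i ∈ range (nScales β + 1), twoLegBar G Q U 1 i) *
            ((1 + 4 / 3 * (G.SL + Q.SL * |U|) * |U|) * (1 + 2 * (4 / 3 * (G.SL + Q.SL * |U|) * |U|))) /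
          (|U| * ((16 : ℝ) ^ nScales β)⁻¹ / 256)⌉₊ ≤ cap β U) :
    ∃ c₄ : ℝ, 0 < c₄ ∧ ∃ U₄ : ℝ, 0 < U₄ ∧ ∀ c U β : ℝ, 0 < c → c ≤ c₄ → 0 < U → U ≤ U₄ →
      klBetaMin ≤ β → β ≤ Real.exp (c / U ^ 2) → ∀ μ ∈ klWindowC,
        (FrameOK (ctRenMs G) U (nScales β) μ 0 ∧ (0 : TrigPolyC4v).degree ≤ cap β U) ∧ ∃ d : ℕ,
          (1 + 4 / 3 * (G.SL + Q.SL * |U|) * |U|) * (1 + 2 * (4 / 3 * (G.SL + Q.SL * |U|) * |U|)) *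
              (π ^ 6 / (d + 1) * ∑ i ∈ range (nScales β + 1), twoLegBar G Q U 1 i) ≤
            |U| * ((16 : ℝ) ^ nScales β)⁻¹ / 256 ∧
          ∀ (L M : ℕ) [NeZero L] [NeZero M],
            ∀ K : TrigPolyC4v, (FrameOK (ctRenMs G) U (nScales β) μ K ∧ K.degree ≤ cap β U) → ∀ n : ℕ, n ≤ nScales β →
              (∀ i ≤ n, TwoLegSizesMSFn L M G Q (ctRenMs G) β U μ K.eval i) →
                FrameOK (ctRenMs G) U (nScales β) μ (ctIterJ L M d β U μ K n) ∧ (ctIterJ L M d β U μ K n).degree ≤ cap β U := by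
  have hR : ∀ j, 0 ≤ (ctRenMs G).Gfr j := (ctRenMs_WF2 hG).1.2.2
  obtain ⟨c₂, hc₂, U₂, hU₂, thr⟩ := ctRenMs_thresholds (G := G) (Q := Q) hG hQ
  refine ⟨c₂, hc₂, min U₂ 1, lt_min hU₂ one_pos, fun c U β hc hcc hU hUU hβ hβc μ hμ => ?_⟩
  have hUU₂ : U ≤ U₂ := hUU.trans (min_le_left _ _)
  have hU1 : U ≤ 1 := hUU.trans (min_le_right _ _)
  obtain ⟨hroomA, hroomB, h0, h1, h2⟩ := thr c U β hc.le hcc hU hUU₂ hβ hβc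
  have hroom := sharpRoom_of_rooms (G := G) (Q := Q) hR hroomA hroomB (nScales β)
  have hμw : μ ∈ Set.Icc (-1.05 : ℝ) (-0.15) := hμ
  have ht : 0 < |U| * ((16 : ℝ) ^ nScales β)⁻¹ / 256 := by have hUa : 0 < |U| := abs_pos.2 hU.ne'; positivity
  set d : ℕ := ⌈π ^ 6 * (∑ i ∈ range (nScales β + 1), twoLegBar G Q U 1 i) *
      ((1 + 4 / 3 * (G.SL + Q.SL * |U|) * |U|) * (1 + 2 * (4 / 3 * (G.SL + Q.SL * |U|) * |U|))) /
        (|U| * ((16 : ℝ) ^ nScales β)⁻¹ / 256)⌉₊ with hd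
  have hdcap : d + d ≤ cap β U := by have := hcap U β hU hU1 hβ; rw [← hd] at this; omega
  refine ⟨⟨frameOK_zero_of_sums hR hμw h0 h1 h2, Nat.zero_le _⟩, d, jacksonDeg_cond _ _ ht, fun L M _ _ K hK n hn hX => ⟨?_, ?_⟩⟩
  · exact frameOK_jackson_of_multiSlotFn' (L := L) (M := M) hG hQ hR hn hμw hX (hroom n hn) h0 h1 h2 d
  · rw [ctIterJ_degree]; exact hdcap

/-- **Provider for the DEGREE-CAPPED class with an ABSTRACT (E3a-MS) conjunct**: `X L M β U μ K i` is any clause yielding a slot decomposition of the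
piece `i` with symmetric `C⁴` slots, own-slot `twoLegBar` sizes and fine sizes under a budget `B U i m j` whose room against `ctRenMs G` holds for
`U ≤ U₅` (`hXroom`); then (R-deg) and an MS re-type together are still ONE provider. -/
theorem selfMapProviderA_degCap_of_slotBudget (G : GeoConsts) (Q : EngConsts) (hG : G.WF) (hQ : Q.WF) (cap : ℝ → ℝ → ℕ)
    (hcap : ∀ U β : ℝ, 0 < U → U ≤ 1 → klBetaMin ≤ β →
      2 * ⌈π ^ 6 * (∑ i ∈ range (nScales β + 1), twoLegBar G Q U 1 i) *
            ((1 + 4 / 3 * (G.SL + Q.SL * |U|) * |U|) * (1 + 2 * (4 / 3 * (G.SL + Q.SL * |U|) * |U|))) /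
          (|U| * ((16 : ℝ) ^ nScales β)⁻¹ / 256)⌉₊ ≤ cap β U)
    (X : ∀ (L M : ℕ) [NeZero L] [NeZero M], ℝ → ℝ → ℝ → TrigPolyC4v → ℕ → Prop) (B : ℝ → ℕ → ℕ → ℕ → ℝ)
    (hB : ∀ U i m j, 0 ≤ B U i m j)
    (hX : ∀ (L M : ℕ) [NeZero L] [NeZero M] (β U μ : ℝ) (K : TrigPolyC4v) (i : ℕ), X L M β U μ K i →
      ∃ lp : ℕ → FrameFn,
        (∀ p : Fin 2 → ℝ, klTwoLegPieceFn L M β U μ K.eval i p = lp i p + ∑ m ∈ Ioc i (nScales β), lp m p) ∧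
        (∀ m, IsSymmetricFrame (lp m) ∧ ContDiff ℝ 4 (onM (lp m))) ∧
        (∀ j ≤ 4, ∀ q : Momentum, ‖iteratedFDeriv ℝ j (onM (lp i)) q‖ ≤ twoLegBar G Q U j i) ∧
        (∀ m ∈ Ioc i (nScales β), ∀ j ≤ 4, ∀ q : Momentum, ‖iteratedFDeriv ℝ j (onM (lp m)) q‖ ≤ B U i m j))
    {U₅ : ℝ} (hU₅ : 0 < U₅)
    (hXroom : ∀ U : ℝ, 0 < U → U ≤ U₅ → ∀ n m : ℕ, ∀ j ≤ 4,
      twoLegBar G Q U j m + ∑ i ∈ (range (n + 1)).filter (· < m), B U i m j ≤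
        (ctRenMs G).Gfr j * uPow j U * (4 : ℝ) ^ (((j : ℤ) - 2) * m)) :
    ∃ c₄ : ℝ, 0 < c₄ ∧ ∃ U₄ : ℝ, 0 < U₄ ∧ ∀ c U β : ℝ, 0 < c → c ≤ c₄ → 0 < U → U ≤ U₄ →
      klBetaMin ≤ β → β ≤ Real.exp (c / U ^ 2) → ∀ μ ∈ klWindowC,
        (FrameOK (ctRenMs G) U (nScales β) μ 0 ∧ (0 : TrigPolyC4v).degree ≤ cap β U) ∧ ∃ d : ℕ,
          (1 + 4 / 3 * (G.SL + Q.SL * |U|) * |U|) * (1 + 2 * (4 / 3 * (G.SL + Q.SL * |U|) * |U|)) *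
              (π ^ 6 / (d + 1) * ∑ i ∈ range (nScales β + 1), twoLegBar G Q U 1 i) ≤
            |U| * ((16 : ℝ) ^ nScales β)⁻¹ / 256 ∧
          ∀ (L M : ℕ) [NeZero L] [NeZero M],
            ∀ K : TrigPolyC4v, (FrameOK (ctRenMs G) U (nScales β) μ K ∧ K.degree ≤ cap β U) → ∀ n : ℕ, n ≤ nScales β →
              (∀ i ≤ n, X L M β U μ K i) →
                FrameOK (ctRenMs G) U (nScales β) μ (ctIterJ L M d β U μ K n) ∧ (ctIterJ L M d β U μ K n).degree ≤ cap β U := by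
  have hR : ∀ j, 0 ≤ (ctRenMs G).Gfr j := (ctRenMs_WF2 hG).1.2.2
  obtain ⟨c₂, hc₂, U₂, hU₂, thr⟩ := ctRenMs_thresholds (G := G) (Q := Q) hG hQ
  refine ⟨c₂, hc₂, min (min U₂ U₅) 1, lt_min (lt_min hU₂ hU₅) one_pos, fun c U β hc hcc hU hUU hβ hβc μ hμ => ?_⟩
  have hUU₂ : U ≤ U₂ := hUU.trans ((min_le_left _ _).trans (min_le_left _ _))
  have hUU₅ : U ≤ U₅ := hUU.trans ((min_le_left _ _).trans (min_le_right _ _))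
  have hU1 : U ≤ 1 := hUU.trans (min_le_right _ _)
  obtain ⟨-, -, h0, h1, h2⟩ := thr c U β hc.le hcc hU hUU₂ hβ hβc
  have hμw : μ ∈ Set.Icc (-1.05 : ℝ) (-0.15) := hμ
  have ht : 0 < |U| * ((16 : ℝ) ^ nScales β)⁻¹ / 256 := by have hUa : 0 < |U| := abs_pos.2 hU.ne'; positivity
  set d : ℕ := ⌈π ^ 6 * (∑ i ∈ range (nScales β + 1), twoLegBar G Q U 1 i) *
      ((1 + 4 / 3 * (G.SL + Q.SL * |U|) * |U|) * (1 + 2 * (4 / 3 * (G.SL + Q.SL * |U|) * |U|))) /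
        (|U| * ((16 : ℝ) ^ nScales β)⁻¹ / 256)⌉₊ with hd
  have hdcap : d + d ≤ cap β U := by have := hcap U β hU hU1 hβ; rw [← hd] at this; omega
  refine ⟨⟨frameOK_zero_of_sums hR hμw h0 h1 h2, Nat.zero_le _⟩, d, jacksonDeg_cond _ _ ht, fun L M _ _ K hK n hn hXn => ⟨?_, ?_⟩⟩
  · exact frameOK_jackson_of_slotBudget (L := L) (M := M) hG hQ hR hn hμw (B := B U) (hB U)
      (fun i hi => hX L M β U μ K i (hXn i hi)) (fun m _ j hj => hXroom U hU hUU₅ n m j hj) h0 h1 h2 d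
  · rw [ctIterJ_degree]; exact hdcap


/-! ## §2 (appended) The cap with a `U`-threshold, and the numeral `2^21·16^{nScales β}` -/

/-- **`π⁶ ≤ 4096`.** -/
theorem pi_pow_six_le : π ^ 6 ≤ 4096 := by
  have h4 : π < 4 := Real.pi_lt_four
  have h0 : 0 ≤ π := Real.pi_pos.le
  nlinarith [pow_le_pow_left₀ h0 h4.le 6]

/-- **Twice the canonical Jackson degree is at most `2^21·16^{nScales β}` for `U` below an explicit `U₆(G, Q)`** (`B₁ ≤ (4/3)(S₁+S₁′|U|)U²`,
`(1+q)(1+2q) ≤ 6` once `q ≤ 1`, `π⁶ ≤ 4096`; the typist's `klFrameDeg N := 2^21·16^N`, p2 g9 STATUS 05:24Z). -/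
theorem two_mul_jacksonDeg_le_numeral (G : GeoConsts) (Q : EngConsts) (hG : G.WF) (hQ : Q.WF) :
    ∃ U₆ : ℝ, 0 < U₆ ∧ ∀ U β : ℝ, 0 < U → U ≤ U₆ → klBetaMin ≤ β →
      2 * ⌈π ^ 6 * (∑ i ∈ range (nScales β + 1), twoLegBar G Q U 1 i) *
            ((1 + 4 / 3 * (G.SL + Q.SL * |U|) * |U|) * (1 + 2 * (4 / 3 * (G.SL + Q.SL * |U|) * |U|))) /
          (|U| * ((16 : ℝ) ^ nScales β)⁻¹ / 256)⌉₊ ≤ 2 ^ 21 * 16 ^ nScales β := by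
  have hS1 : 0 ≤ G.S 1 := hG.2.2.2.2.2.2.2.2.2.2.2.2.2.2.2.2.2.1 1
  have hS1' : 0 ≤ Q.S' 1 := hQ.2.2.2.2.1 1
  have hSL : 0 ≤ G.SL := hG.2.2.2.2.2.2.2.2.2.2.2.2.2.2.2.2.2.2.2
  have hSL' : 0 ≤ Q.SL := hQ.2.2.2.2.2.2.1
  set A : ℝ := G.S 1 + Q.S' 1 + 1 with hA
  have hApos : 0 < A := by rw [hA]; linarith
  refine ⟨min 1 (min (3 / (4 * (G.SL + Q.SL + 1))) (1 / (8 * A))), lt_min one_pos (lt_min (by positivity) (by positivity)), ?_⟩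
  intro U β hU hUle _
  have hU1 : U ≤ 1 := hUle.trans (min_le_left _ _)
  have hUq : U ≤ 3 / (4 * (G.SL + Q.SL + 1)) := hUle.trans ((min_le_right _ _).trans (min_le_left _ _))
  have hUA : U ≤ 1 / (8 * A) := hUle.trans ((min_le_right _ _).trans (min_le_right _ _))
  have habs : |U| = U := abs_of_pos hU
  set N := nScales β with hN
  set q : ℝ := 4 / 3 * (G.SL + Q.SL * |U|) * |U| with hq
  set B1 : ℝ := ∑ i ∈ range (N + 1), twoLegBar G Q U 1 i with hB1
  set P : ℝ := (1 + q) * (1 + 2 * q) with hP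
  set t : ℝ := |U| * ((16 : ℝ) ^ N)⁻¹ / 256 with ht
  have h16 : (0 : ℝ) < (16 : ℝ) ^ N := by positivity
  have htpos : 0 < t := by rw [ht, habs]; positivity
  -- `q ≤ 1`, hence `P ≤ 6`
  have hq0 : 0 ≤ q := by rw [hq]; positivity
  have hq1 : q ≤ 1 := by
    rw [hq, habs]
    have h1 : Q.SL * U ≤ Q.SL := by nlinarith
    have h2 : 4 / 3 * (G.SL + Q.SL * U) * U ≤ 4 / 3 * (G.SL + Q.SL + 1) * U := by nlinarith
    have h3 : 4 / 3 * (G.SL + Q.SL + 1) * U ≤ 1 := by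
      have hden : 0 < 4 * (G.SL + Q.SL + 1) := by positivity
      have := (le_div_iff₀ hden).mp hUq
      nlinarith
    linarith
  have hP6 : P ≤ 6 := by rw [hP]; nlinarith
  have hP0 : 0 ≤ P := by rw [hP]; positivity
  -- `B₁ ≤ (4/3)(S₁ + S₁′U)U² ≤ (4/3)·A·U²`
  have hB1le : B1 ≤ 4 / 3 * A * U ^ 2 := by
    have h := sum_twoLegBar_one_le G Q U (by rw [habs]; positivity) (N + 1)
    rw [habs] at h
    have h' : G.S 1 + Q.S' 1 * U ≤ A := by rw [hA]; nlinarith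
    have hU2 : 0 ≤ U ^ 2 := sq_nonneg U
    calc B1 ≤ 4 / 3 * (G.S 1 + Q.S' 1 * U) * U ^ 2 := h
      _ ≤ 4 / 3 * A * U ^ 2 := by nlinarith
  have hB10 : 0 ≤ B1 := sum_nonneg fun i _ => twoLegBar_nonneg' hG hQ U 1 i
  -- the degree's real bound: `X = π⁶ B₁ P / t ≤ 2^15·A·U²·256·16^N/U ≤ 2^20·16^N`
  have hX : π ^ 6 * B1 * P / t ≤ (2 : ℝ) ^ 20 * (16 : ℝ) ^ N := by
    rw [div_le_iff₀ htpos, ht, habs]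
    have hpi := pi_pow_six_le
    have hBP : B1 * P ≤ 4 / 3 * A * U ^ 2 * 6 := mul_le_mul hB1le hP6 hP0 (by positivity)
    have h1 : π ^ 6 * (B1 * P) ≤ 4096 * (4 / 3 * A * U ^ 2 * 6) :=
      mul_le_mul hpi hBP (mul_nonneg hB10 hP0) (by norm_num)
    have h8A : 0 < 8 * A := by positivity
    have hUA' : U * (8 * A) ≤ 1 := (le_div_iff₀ h8A).mp hUA
    have hrhs : (2 : ℝ) ^ 20 * (16 : ℝ) ^ N * (U * ((16 : ℝ) ^ N)⁻¹ / 256) = 4096 * U := by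
      field_simp; ring
    have h2 : 4096 * (4 / 3 * A * U ^ 2 * 6) = 4096 * U * (U * (8 * A)) := by ring
    have hkey : 4096 * U * (U * (8 * A)) ≤ 4096 * U * 1 := mul_le_mul_of_nonneg_left hUA' (by positivity)
    rw [hrhs, show π ^ 6 * B1 * P = π ^ 6 * (B1 * P) by ring]
    linarith
  have hceil : ⌈π ^ 6 * B1 * P / t⌉₊ ≤ 2 ^ 20 * 16 ^ N := by
    refine Nat.ceil_le.mpr ?_
    push_cast
    linarith [hX, show (2:ℝ) ^ 20 = 1048576 by norm_num]
  omega

/-- **Provider for the DEGREE-CAPPED class, today's (E3a-MS) text, cap with a `U`-threshold**: as `selfMapProviderA_degCap`, but `hcap` is asked only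
below some `U₆ > 0` (the form `two_mul_jacksonDeg_le_numeral` delivers). -/
theorem selfMapProviderA_degCap' (G : GeoConsts) (Q : EngConsts) (hG : G.WF) (hQ : Q.WF) (cap : ℝ → ℝ → ℕ)
    (hcap : ∃ U₆ : ℝ, 0 < U₆ ∧ ∀ U β : ℝ, 0 < U → U ≤ U₆ → klBetaMin ≤ β →
      2 * ⌈π ^ 6 * (∑ i ∈ range (nScales β + 1), twoLegBar G Q U 1 i) *
            ((1 + 4 / 3 * (G.SL + Q.SL * |U|) * |U|) * (1 + 2 * (4 / 3 * (G.SL + Q.SL * |U|) * |U|))) /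
          (|U| * ((16 : ℝ) ^ nScales β)⁻¹ / 256)⌉₊ ≤ cap β U) :
    ∃ c₄ : ℝ, 0 < c₄ ∧ ∃ U₄ : ℝ, 0 < U₄ ∧ ∀ c U β : ℝ, 0 < c → c ≤ c₄ → 0 < U → U ≤ U₄ →
      klBetaMin ≤ β → β ≤ Real.exp (c / U ^ 2) → ∀ μ ∈ klWindowC,
        (FrameOK (ctRenMs G) U (nScales β) μ 0 ∧ (0 : TrigPolyC4v).degree ≤ cap β U) ∧ ∃ d : ℕ,
          (1 + 4 / 3 * (G.SL + Q.SL * |U|) * |U|) * (1 + 2 * (4 / 3 * (G.SL + Q.SL * |U|) * |U|)) *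
              (π ^ 6 / (d + 1) * ∑ i ∈ range (nScales β + 1), twoLegBar G Q U 1 i) ≤
            |U| * ((16 : ℝ) ^ nScales β)⁻¹ / 256 ∧
          ∀ (L M : ℕ) [NeZero L] [NeZero M],
            ∀ K : TrigPolyC4v, (FrameOK (ctRenMs G) U (nScales β) μ K ∧ K.degree ≤ cap β U) → ∀ n : ℕ, n ≤ nScales β →
              (∀ i ≤ n, TwoLegSizesMSFn L M G Q (ctRenMs G) β U μ K.eval i) →
                FrameOK (ctRenMs G) U (nScales β) μ (ctIterJ L M d β U μ K n) ∧ (ctIterJ L M d β U μ K n).degree ≤ cap β U := by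
  have hR : ∀ j, 0 ≤ (ctRenMs G).Gfr j := (ctRenMs_WF2 hG).1.2.2
  obtain ⟨c₂, hc₂, U₂, hU₂, thr⟩ := ctRenMs_thresholds (G := G) (Q := Q) hG hQ
  obtain ⟨U₆, hU₆, hcap⟩ := hcap
  refine ⟨c₂, hc₂, min U₂ U₆, lt_min hU₂ hU₆, fun c U β hc hcc hU hUU hβ hβc μ hμ => ?_⟩
  have hUU₂ : U ≤ U₂ := hUU.trans (min_le_left _ _)
  have hUU₆ : U ≤ U₆ := hUU.trans (min_le_right _ _)
  obtain ⟨hroomA, hroomB, h0, h1, h2⟩ := thr c U β hc.le hcc hU hUU₂ hβ hβc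
  have hroom := sharpRoom_of_rooms (G := G) (Q := Q) hR hroomA hroomB (nScales β)
  have hμw : μ ∈ Set.Icc (-1.05 : ℝ) (-0.15) := hμ
  have ht : 0 < |U| * ((16 : ℝ) ^ nScales β)⁻¹ / 256 := by have hUa : 0 < |U| := abs_pos.2 hU.ne'; positivity
  set d : ℕ := ⌈π ^ 6 * (∑ i ∈ range (nScales β + 1), twoLegBar G Q U 1 i) *
      ((1 + 4 / 3 * (G.SL + Q.SL * |U|) * |U|) * (1 + 2 * (4 / 3 * (G.SL + Q.SL * |U|) * |U|))) /
        (|U| * ((16 : ℝ) ^ nScales β)⁻¹ / 256)⌉₊ with hd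
  have hdcap : d + d ≤ cap β U := by have := hcap U β hU hUU₆ hβ; rw [← hd] at this; omega
  refine ⟨⟨frameOK_zero_of_sums hR hμw h0 h1 h2, Nat.zero_le _⟩, d, jacksonDeg_cond _ _ ht, fun L M _ _ K hK n hn hX => ⟨?_, ?_⟩⟩
  · exact frameOK_jackson_of_multiSlotFn' (L := L) (M := M) hG hQ hR hn hμw hX (hroom n hn) h0 h1 h2 d
  · rw [ctIterJ_degree]; exact hdcap

/-- **Provider for the class `FrameOK ∧ K.degree ≤ 2^21·16^{nScales β}` with today's (E3a-MS) text** — the typist's proposed `klFrameDeg`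
numeral (p2 g9), no hypothesis left. -/
theorem selfMapProviderA_degCap_numeral (G : GeoConsts) (Q : EngConsts) (hG : G.WF) (hQ : Q.WF) :
    ∃ c₄ : ℝ, 0 < c₄ ∧ ∃ U₄ : ℝ, 0 < U₄ ∧ ∀ c U β : ℝ, 0 < c → c ≤ c₄ → 0 < U → U ≤ U₄ →
      klBetaMin ≤ β → β ≤ Real.exp (c / U ^ 2) → ∀ μ ∈ klWindowC,
        (FrameOK (ctRenMs G) U (nScales β) μ 0 ∧ (0 : TrigPolyC4v).degree ≤ 2 ^ 21 * 16 ^ nScales β) ∧ ∃ d : ℕ,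
          (1 + 4 / 3 * (G.SL + Q.SL * |U|) * |U|) * (1 + 2 * (4 / 3 * (G.SL + Q.SL * |U|) * |U|)) *
              (π ^ 6 / (d + 1) * ∑ i ∈ range (nScales β + 1), twoLegBar G Q U 1 i) ≤
            |U| * ((16 : ℝ) ^ nScales β)⁻¹ / 256 ∧
          ∀ (L M : ℕ) [NeZero L] [NeZero M],
            ∀ K : TrigPolyC4v, (FrameOK (ctRenMs G) U (nScales β) μ K ∧ K.degree ≤ 2 ^ 21 * 16 ^ nScales β) →
              ∀ n : ℕ, n ≤ nScales β → (∀ i ≤ n, TwoLegSizesMSFn L M G Q (ctRenMs G) β U μ K.eval i) →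
                FrameOK (ctRenMs G) U (nScales β) μ (ctIterJ L M d β U μ K n) ∧
                  (ctIterJ L M d β U μ K n).degree ≤ 2 ^ 21 * 16 ^ nScales β :=
  selfMapProviderA_degCap' G Q hG hQ (fun β _ => 2 ^ 21 * 16 ^ nScales β) (two_mul_jacksonDeg_le_numeral G Q hG hQ)

end Summit.HubbardSuperconductivity.HubbardSuperconductivity.Theorems.KLRegimeSplit

end
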